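import Summits.BirchSwinnertonDyer.BirchSwinnertonDyer.Theorems.Rank1ResidualX9CMPartner
import Literature.NumberTheory.EllipticCurves.Rank1Residual.X9TrivialPartner
import Literature.NumberTheory.EllipticCurves.Wuthrich2014.RankOneConverseOddPrimeProofs
import HarnessLib

/-!
# Congruence-transport road U2 (trivial `p`-primary partner), FLAG-FREE and in BOTH analytic ranks, at
# every ODD good ordinary prime with irreducible `E[p]` — hence on both leaves `ClassX9` (`p = 5, 7`) and
# `ClassX10b` (`p = 3`): `BSD(E,p)` per pair from Kato 17.4 (1), Greenberg 4.1, the period units,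
# Greenberg–Vatsal (1.4), Perrin-Riou–Schneider / Perrin-Riou 1987 / Mazur–Tate σ at odd `p`,
# modularity, GZK, the partner's finite certificates and (rank 1) the Schneider certificate

Cell `bsd-print-x9` (D-0131 (2) print tier), seat `bsd-print-x9-p2` (prover; road «μ = 0 / main
conjecture by congruence transport (Greenberg–Vatsal 2000 (1.4)) + certificates»). `--supports` helper of
the K6 crux item 19629 (`MuTransfer`): on the trivial-partner locus this file is the F1-FREE per-pair
alternative to the μ-transfer (no Kato zeta-element package, no BCS 2025, no Yan–Zhu). HONEST FRAMING:
theorems only; no definition, no named fact, nothing asserted about any curve, nothing booked (the lane's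
records instantiate, the referee rules); PER PAIR — never a class theorem (`BSDpOnClassX9`,
`X10.BSDpOnClassX10b` stay open; their class-wide residual is Greenberg's `μ = 0` / stmt-19630).
Beyond-print theorem: NO.

## What is new relative to `Rank1Residual/X9TrivialPartner.lean` (b2b x9 gen 5 / x10)

There: `bsdp_of_trivialPartner_of_goodOrd` — route U2 at any odd good ordinary prime, BCS-free (Kato 17.4
(1) for torsion, `charIdeal_isPrincipal_holds`), analytic rank **0** only ("the rank-1 half of X10b is NOT
touched (the rank-one engine needs `p ≥ 5`)"), and `X9.bsdp_of_trivialPartner_of_analyticRank_eq_one` —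
rank 1 at `p ≥ 5` through BCS 2025 Thm. 1.1.2 (a) (`hBCS`, a FLAGGED fact in the print cell's currency,
REF-AUDIT §0.C). Since then the odd-prime rank-one engine exists
(`Wuthrich2014.missingPPartAt_of_mainConjecture_of_rank_one_odd`, x1b gen 4: Perrin-Riou–Schneider +
Perrin-Riou 1987 + the Mazur–Tate σ at odd `p`, no image hypothesis). Here:

* `mazurMainConjecture_of_trivialPartner_of_goodOrd` — Mazur's main conjecture for `(E, p)` in the Néron
  normalisation (the body of `Rank1ResidualX1Defs.MazurMainConjecture W p`) at ANY odd good ordinary prime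
  with `E[p]` irreducible, from a congruent partner `A` with trivial `p`-primary arithmetic: Kato 17.4 (1)
  + Greenberg 4.1 + period units give the main conjecture with `μ = 0` for `A`
  (`mazurMainConjecture_with_mu_zero_of_trivialArithmetic_odd`), Greenberg–Vatsal (1.4) + Kato (1.2)
  transport it along `A[p] ≃ E[p]` (`GreenbergVatsal2000.mazurMainConjecture_of_thm14`). BCS-FREE.
* `bsdp_of_trivialPartner_of_goodOrd_of_analyticRank_le_one` — `BSD(E,p)` in analytic rank `≤ 1` at any
  odd good ordinary irreducible prime from the same partner data plus, in rank 1, the Schneider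
  certificate `hC3` for `E` (rank 0: b2b's theorem verbatim; rank 1: the main conjecture above into the
  odd-prime engine and `Typed.bsdp_of_missingPPartAt`). BCS-free, YZ-free, F1-free: every named-fact binder
  is an unflagged published theorem (Kato 17.4, Greenberg 4.1, GV §3 Rem. 3.4 / Mazur 1978, GV (1.4),
  Schneider 1985 / BMS 2015 Thm. 1.7, Perrin-Riou 1987, Mazur–Tate 1991, BCDT 2001, GZK).
* `bsdp_of_classX9_of_trivialPartner_odd` — the same on the leaf predicate `Rank1Residual.ClassX9 W p`
  (this sub-problem's `Rank1ResidualX9Defs.ClassX9`, `p ∈ {5,7}`), both ranks;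
* `bsdp_of_classX10b_of_trivialPartner` — the same on `ClassX10 W p ∧ ¬ Surj W 3` (`p = 3`), both ranks
  (the rank-1 half of X10b on route U2, previously untouched).

Reach (honest): a partner of an ANOMALOUS pair is anomalous (`X10.dvd_frobeniusTrace_sub_one_iff_of_torsionIso`,
`dvd_frobeniusTrace_sub_one_of_torsionIso_of_classX9`), so U2 never reaches the 119 anomalous X9 census
pairs nor the 138 anomalous N2 cells; and the partner's `#Sel_{p^∞}(A/ℚ) = 1` is a certificate the lane
supplies (Creutz–Miller at `N_A < 5000`, `natCard_selmerGroupPInfty_eq_one_of_conductor_lt`; or an exact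
`p`-descent).

References: K. Kato, Astérisque 295 (2004) Thm. 17.4 (1) [Kato2004Asterisque]; R. Greenberg, LNM 1716
(1999) Thm. 4.1 [GreenbergLNM1716]; R. Greenberg, V. Vatsal, Invent. Math. 142 (2000) Thm. (1.4), §3 Rem.
(3.4) [GreenbergVatsal2000]; B. Perrin-Riou, Invent. Math. 89 (1987) §1.4 [PerrinRiou1987];
J. Balakrishnan, J. S. Müller, W. Stein, Math. Comp. 85 (2016) Thm. 1.7 [BalakrishnanMullerStein2015];
B. Mazur, J. Tate, Duke Math. J. 62 (1991) [MazurTate1991]; C. Wuthrich, Doc. Math. 19 (2014) §§6–8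
[Wuthrich2014]; R. L. Miller, LMS J. Comput. Math. 14 (2011) Def. 1.1 [Miller2011LMS].
-/

-- the summit and its single problem are both named `BirchSwinnertonDyer` (registry layout D-0017)
set_option linter.dupNamespace false

set_option autoImplicit false

noncomputable section

open scoped Classical MatrixGroups ModularForm

open CongruenceSubgroup WeierstrassCurve Field
open Literature.NumberTheory.EllipticCurves Literature.NumberTheory.EllipticCurves.ModularForms
open Literature.NumberTheory.EllipticCurves.Rank1Residual

namespace Summit.BirchSwinnertonDyer.BirchSwinnertonDyer.Rank1Residual

section OddPrime

variable (W A : WeierstrassCurve ℚ) [W.IsElliptic] [W.IsGloballyMinimal] [A.IsElliptic]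
  [A.IsGloballyMinimal] (p : ℕ) [Fact p.Prime]

/-- **Mazur's main conjecture for `(E, p)` from a congruent partner with trivial `p`-primary arithmetic,
at any ODD good ordinary prime with `E[p]` irreducible (route U2, BCS-free).** `W` globally minimal,
`p ≠ 2` good ordinary for `W`, `E[p]` irreducible; `A` a globally minimal partner, good ordinary at `p`,
with the certificates `hna` (`p ∤ #Ã(𝔽_p)`), `htam` (`p ∤ ∏ c_ℓ(A)`), `hL` (`L(A,1)/Ω_A` a non-zero
rational of valuation `0`), `hSel` (`#Sel_{p^∞}(A/ℚ) = 1`) and C1 (`hC1`: `Γ_ℚ`-equivariant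
`A[p] ≃ E[p]`). Then for all cyclotomic data, the newform of `W` at level `N_E`, every `ϖ` with
`ϖ·Ω_E = Ω⁺_f` and every dual datum: `X(E/ℚ_∞)` is `Λ`-torsion with `char_Λ X = (g)`,
`ι g = ϖ·L_p(f, α)` — the body of `MazurMainConjecture W p`. Inputs: Kato 17.4 (1) (`hkato`), Greenberg
4.1 (`hGr`), the period units (`h5`, `h3`) — through `mazurMainConjecture_with_mu_zero_of_trivialArithmetic_odd`
for `A` — and Greenberg–Vatsal (1.4) + Kato (1.2) (`hGV`) along C1.
[cite: Kato2004Asterisque, Thm. 17.4 (1) (p. 273)] [cite: GreenbergVatsal2000, Thm. (1.4) (arXiv p. 5)]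
[cite: GreenbergLNM1716, Thm. 4.1 (p. 102)] -/
theorem mazurMainConjecture_of_trivialPartner_of_goodOrd
    (hkato : ∀ (W : WeierstrassCurve ℚ) [W.IsElliptic] [W.IsGloballyMinimal] (p : ℕ) [Fact p.Prime]
      (κ : ZpExtension ℚ p) (γ : Field.absoluteGaloisGroup ℚ) (N : ℕ) [NeZero N]
      (f : CuspForm (Gamma0 N) 2), kato_divisibility W p (κ := κ) (γ := γ) (f := f))
    (hGr : greenberg_charValue_rankZero) (h5 : realPeriodRat_eq_unit_mul_plusPeriod)
    (h3 : realPeriodRat_eq_unit_mul_plusPeriod_three)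
    (hGV : GreenbergVatsal2000.thm14_mainConjecture_transfer_of_torsionIso)
    (hp2 : p ≠ 2) (hgood : W.HasGoodReductionAtPrime p) (hord : ¬ (p : ℤ) ∣ W.frobeniusTrace p)
    (hirr : W.HasIrreducibleModPGaloisRep p)
    (hgoodA : A.HasGoodReductionAtPrime p) (hordA : ¬ (p : ℤ) ∣ A.frobeniusTrace p)
    (hna : ¬ p ∣ A.reductionPointCount p) (htam : ¬ p ∣ A.tamagawaProduct)
    (hL : ∃ q : ℚ, q ≠ 0 ∧ A.entireLFunction 1 / (A.realPeriodRat : ℂ) = (q : ℂ) ∧ padicValRat p q = 0)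
    (hSel : Nat.card (A.selmerGroupPInfty p) = 1)
    (hC1 : ∃ e : geomTorsion A (p : ℤ) ≃+ geomTorsion W (p : ℤ),
      ∀ (σ : Field.absoluteGaloisGroup ℚ) (P : geomTorsion A (p : ℤ)), e (σ • P) = σ • e P) :
    ∀ (κ : ZpExtension ℚ p) (γ : Field.absoluteGaloisGroup ℚ),
        κ.IsCyclotomic → κ.IsTopGenerator γ → IsCyclotomicVariable p γ →
      ∀ [NeZero (W.conductorNorm ℤ)] (f : CuspForm (Gamma0 (W.conductorNorm ℤ)) 2),
        IsNewformOf W f → ∀ (ϖ : ℚ), (ϖ : ℝ) * W.realPeriodRat = plusPeriod f →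
      ∀ (D : W.SelmerDualData κ γ), D.IsTorsion ∧
        ∃ g : IwasawaAlgebra p, D.charIdeal = Ideal.span {g} ∧
          iwasawaToPowerSeries p g =
            PowerSeries.C (ϖ : ℚ_[p]) * padicLFunction f (unitRoot W p : ℚ_[p]) := by
  obtain ⟨e, he⟩ := hC1
  have hirrA : A.HasIrreducibleModPGaloisRep p :=
    hasIrreducibleModPGaloisRep_of_torsionIso_symm e he hirr
  exact GreenbergVatsal2000.mazurMainConjecture_of_thm14 A W p hGV hp2 hgoodA hordA hgood hord ⟨e, he⟩
    hirrA
    (mazurMainConjecture_with_mu_zero_of_trivialArithmetic_odd hkato hGr h5 h3 A p hp2 hgoodA hordA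
      hirrA hna htam hL hSel)

/-- **Route U2 at any odd good ordinary prime, analytic rank `≤ 1`, BCS-free: `BSD(E,p)` from a
congruent partner with trivial `p`-primary arithmetic (+ the Schneider certificate in rank 1).** As
`bsdp_of_trivialPartner_of_goodOrd` (rank 0, b2b) with `W.analyticRank ≤ 1` and, for the rank-1 case,
the per-pair certificate `hC3` (Schneider's non-degeneracy of the canonical cyclotomic `p`-adic height of
`E`, ⟺ `[T¹]L_p ≠ 0`) fed, together with `mazurMainConjecture_of_trivialPartner_of_goodOrd`, into the
odd-prime engine `Wuthrich2014.missingPPartAt_of_mainConjecture_of_rank_one_odd` (Perrin-Riou–Schneider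
`hS`, Perrin-Riou 1987 `hPR`, Mazur–Tate σ `hMT`, modularity `hmodP`, GZK `hGZK`). PUBLISHED binders, all
unflagged: `hkato`, `hGr`, `h5`, `h3`, `hGV`, `hS`, `hPR`, `hMT`, `hmodP`, `hmodL`, `hGZK`. No pair is
closed by this theorem until its certificates are certified for it.
[cite: GreenbergVatsal2000, Thm. (1.4) (arXiv p. 5)] [cite: PerrinRiou1987, §1.4 Cor. 1.8]
[cite: BalakrishnanMullerStein2015, Thm. 1.7] [cite: Miller2011LMS, Def. 1.1] -/
theorem bsdp_of_trivialPartner_of_goodOrd_of_analyticRank_le_one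
    (hkato : ∀ (W : WeierstrassCurve ℚ) [W.IsElliptic] [W.IsGloballyMinimal] (p : ℕ) [Fact p.Prime]
      (κ : ZpExtension ℚ p) (γ : Field.absoluteGaloisGroup ℚ) (N : ℕ) [NeZero N]
      (f : CuspForm (Gamma0 N) 2), kato_divisibility W p (κ := κ) (γ := γ) (f := f))
    (hGr : greenberg_charValue_rankZero) (h5 : realPeriodRat_eq_unit_mul_plusPeriod)
    (h3 : realPeriodRat_eq_unit_mul_plusPeriod_three)
    (hGV : GreenbergVatsal2000.thm14_mainConjecture_transfer_of_torsionIso)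
    (hS : Schneider1985_order_charGenerator_odd) (hPR : perrinRiou_rankOne_leadingTerms_odd)
    (hMT : mazur_tate_sigma_exists_odd)
    (hmodP : nonempty_modularParametrizationData) (hmodL : hasEntireLFunction_rat)
    (hGZK : rank_eq_analyticRank_of_analyticRank_le_one)
    (hp2 : p ≠ 2) (hgood : W.HasGoodReductionAtPrime p) (hord : ¬ (p : ℤ) ∣ W.frobeniusTrace p)
    (hirr : W.HasIrreducibleModPGaloisRep p) (hran : W.analyticRank ≤ 1)
    (hgoodA : A.HasGoodReductionAtPrime p) (hordA : ¬ (p : ℤ) ∣ A.frobeniusTrace p)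
    (hna : ¬ p ∣ A.reductionPointCount p) (htam : ¬ p ∣ A.tamagawaProduct)
    (hL : ∃ q : ℚ, q ≠ 0 ∧ A.entireLFunction 1 / (A.realPeriodRat : ℂ) = (q : ℂ) ∧ padicValRat p q = 0)
    (hSel : Nat.card (A.selmerGroupPInfty p) = 1)
    (hC1 : ∃ e : geomTorsion A (p : ℤ) ≃+ geomTorsion W (p : ℤ),
      ∀ (σ : Field.absoluteGaloisGroup ℚ) (P : geomTorsion A (p : ℤ)), e (σ • P) = σ • e P)
    (hC3 : W.analyticRank = 1 → ∀ Dh : PAdicHeightData W p, Dh.IsCanonical → SchneiderConjecture Dh) :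
    BSDp W p := by
  rcases Nat.le_one_iff_eq_zero_or_eq_one.mp hran with hr | hr
  · exact bsdp_of_trivialPartner_of_goodOrd W A p hkato hGr h5 h3 hGV hmodP hmodL hGZK hp2 hgood hord
      hirr hr hgoodA hordA hna htam hL hSel hC1
  · exact Typed.bsdp_of_missingPPartAt W p hGZK hran
      (Wuthrich2014.missingPPartAt_of_mainConjecture_of_rank_one_odd hS hPR hMT hmodP hGZK W p hp2
        hgood hord hr (hC3 hr)
        (mazurMainConjecture_of_trivialPartner_of_goodOrd W A p hkato hGr h5 h3 hGV hp2 hgood hord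
          hirr hgoodA hordA hna htam hL hSel hC1))

/-- **Leaf `ClassX9` (this sub-problem's `Rank1ResidualX9Defs.ClassX9`: non-CM, `p ≥ 5` good ordinary,
`E[p]` irreducible, `ρ̄` not surjective), per pair, both analytic ranks, flag-free**: `BSD(E,p)` from a
trivial-arithmetic `p`-congruent partner (+ Schneider certificate in rank 1). Specialisation of
`bsdp_of_trivialPartner_of_goodOrd_of_analyticRank_le_one` (`p ≥ 5 ⇒ p ≠ 2`).
[cite: GreenbergVatsal2000, Thm. (1.4) (arXiv p. 5)] [cite: Miller2011LMS, Def. 1.1] -/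
theorem bsdp_of_classX9_of_trivialPartner_odd
    (hkato : ∀ (W : WeierstrassCurve ℚ) [W.IsElliptic] [W.IsGloballyMinimal] (p : ℕ) [Fact p.Prime]
      (κ : ZpExtension ℚ p) (γ : Field.absoluteGaloisGroup ℚ) (N : ℕ) [NeZero N]
      (f : CuspForm (Gamma0 N) 2), kato_divisibility W p (κ := κ) (γ := γ) (f := f))
    (hGr : greenberg_charValue_rankZero) (h5 : realPeriodRat_eq_unit_mul_plusPeriod)
    (h3 : realPeriodRat_eq_unit_mul_plusPeriod_three)
    (hGV : GreenbergVatsal2000.thm14_mainConjecture_transfer_of_torsionIso)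
    (hS : Schneider1985_order_charGenerator_odd) (hPR : perrinRiou_rankOne_leadingTerms_odd)
    (hMT : mazur_tate_sigma_exists_odd)
    (hmodP : nonempty_modularParametrizationData) (hmodL : hasEntireLFunction_rat)
    (hGZK : rank_eq_analyticRank_of_analyticRank_le_one)
    (hX9 : ClassX9 W p) (hran : W.analyticRank ≤ 1)
    (hgoodA : A.HasGoodReductionAtPrime p) (hordA : ¬ (p : ℤ) ∣ A.frobeniusTrace p)
    (hna : ¬ p ∣ A.reductionPointCount p) (htam : ¬ p ∣ A.tamagawaProduct)
    (hL : ∃ q : ℚ, q ≠ 0 ∧ A.entireLFunction 1 / (A.realPeriodRat : ℂ) = (q : ℂ) ∧ padicValRat p q = 0)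
    (hSel : Nat.card (A.selmerGroupPInfty p) = 1)
    (hC1 : ∃ e : geomTorsion A (p : ℤ) ≃+ geomTorsion W (p : ℤ),
      ∀ (σ : Field.absoluteGaloisGroup ℚ) (P : geomTorsion A (p : ℤ)), e (σ • P) = σ • e P)
    (hC3 : W.analyticRank = 1 → ∀ Dh : PAdicHeightData W p, Dh.IsCanonical → SchneiderConjecture Dh) :
    BSDp W p := by
  obtain ⟨-, hp, hgood, hord, hirr, -⟩ := hX9
  have hp2 : p ≠ 2 := by omega
  exact bsdp_of_trivialPartner_of_goodOrd_of_analyticRank_le_one W A p hkato hGr h5 h3 hGV hS hPR hMT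
    hmodP hmodL hGZK hp2 hgood hord hirr hran hgoodA hordA hna htam hL hSel hC1 hC3

/-- **Leaf `ClassX10b` (`ClassX10 W p ∧ ¬ Surj W 3`: `p = 3` good ordinary, `E[3]` irreducible, analytic
rank `0 ∧ ¬(ram)` or `1 ∧ ¬semistable`, `ρ̄_{E,3}` not surjective — `_hns` recorded, not used), per pair,
BOTH analytic ranks, flag-free**: `BSD(E,3)` from a trivial-arithmetic `3`-congruent partner (+ the
Schneider certificate at `3` in rank 1). The rank-0 half is b2b's `X10b.bsdp_of_trivialPartner`; the rank-1
half is new on route U2 (odd-prime engine). [cite: GreenbergVatsal2000, Thm. (1.4) (arXiv p. 5)]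
[cite: Miller2011LMS, Def. 1.1] -/
theorem bsdp_of_classX10b_of_trivialPartner
    (hkato : ∀ (W : WeierstrassCurve ℚ) [W.IsElliptic] [W.IsGloballyMinimal] (p : ℕ) [Fact p.Prime]
      (κ : ZpExtension ℚ p) (γ : Field.absoluteGaloisGroup ℚ) (N : ℕ) [NeZero N]
      (f : CuspForm (Gamma0 N) 2), kato_divisibility W p (κ := κ) (γ := γ) (f := f))
    (hGr : greenberg_charValue_rankZero) (h5 : realPeriodRat_eq_unit_mul_plusPeriod)
    (h3 : realPeriodRat_eq_unit_mul_plusPeriod_three)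
    (hGV : GreenbergVatsal2000.thm14_mainConjecture_transfer_of_torsionIso)
    (hS : Schneider1985_order_charGenerator_odd) (hPR : perrinRiou_rankOne_leadingTerms_odd)
    (hMT : mazur_tate_sigma_exists_odd)
    (hmodP : nonempty_modularParametrizationData) (hmodL : hasEntireLFunction_rat)
    (hGZK : rank_eq_analyticRank_of_analyticRank_le_one)
    (hX10 : Literature.NumberTheory.EllipticCurves.Rank1Residual.ClassX10 W p) (_hns : ¬ Surj W 3)
    (hgoodA : A.HasGoodReductionAtPrime p) (hordA : ¬ (p : ℤ) ∣ A.frobeniusTrace p)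
    (hna : ¬ p ∣ A.reductionPointCount p) (htam : ¬ p ∣ A.tamagawaProduct)
    (hL : ∃ q : ℚ, q ≠ 0 ∧ A.entireLFunction 1 / (A.realPeriodRat : ℂ) = (q : ℂ) ∧ padicValRat p q = 0)
    (hSel : Nat.card (A.selmerGroupPInfty p) = 1)
    (hC1 : ∃ e : geomTorsion A (p : ℤ) ≃+ geomTorsion W (p : ℤ),
      ∀ (σ : Field.absoluteGaloisGroup ℚ) (P : geomTorsion A (p : ℤ)), e (σ • P) = σ • e P)
    (hC3 : W.analyticRank = 1 → ∀ Dh : PAdicHeightData W p, Dh.IsCanonical → SchneiderConjecture Dh) :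
    BSDp W p := by
  obtain ⟨hp3, ⟨hgood, hord⟩, hirr, hr⟩ := hX10
  subst hp3
  have hran : W.analyticRank ≤ 1 := by
    rcases hr with ⟨h0, -⟩ | ⟨h1, -⟩ <;> omega
  exact bsdp_of_trivialPartner_of_goodOrd_of_analyticRank_le_one W A 3 hkato hGr h5 h3 hGV hS hPR hMT
    hmodP hmodL hGZK (by decide) hgood hord hirr hran hgoodA hordA hna htam hL hSel hC1 hC3

end OddPrime

end Summit.BirchSwinnertonDyer.BirchSwinnertonDyer.Rank1Residual

end
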